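import Summits.NavierStokesRegularity.NavierStokesRegularity.Theorems.SqueezeCycleSingularZoomLocal
import Literature.Analysis.FluidPDE.LocalTypeIPersistenceHolds
import Literature.Analysis.FluidPDE.LocalTypeIProofs
import Mathlib.MeasureTheory.Function.ConvergenceInMeasure
import HarnessLib

/-!
# The Type-I zoom sequence of a classical solution at a final-time point
# (route `SqueezeCycle`, item `SingularZoom`, stmt-NavierStokesRegularity-10573), III: persistence of the
# singularity

Helper file (theorems only).

* `eLpNorm_top_unitZoom_eq_top`, `eLpNorm_top_zoomIn_eq_top` — if `(T, x₀)` is a backward singular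
  point of the classical solution `u` (`u` essentially unbounded on every `Q_r(T, x₀)`), then the unit
  zoom `v = α • stPull β R T x₀ u` is essentially unbounded on every `Q(0, ρ)`, `0 < ρ ≤ 1`
  (contrapositive of the tree's `SereginSverak2002.isBackwardBoundedAt_of_zoom`), and so is every
  further zoom `v_c` on every `Q(0, R')` with `c R' ≤ 1` (`eLpNorm_top_nsZoom`).
* `unbounded_at_origin_of_zoomIn_limit` — **persistence of the singularity in the limit**
  (Rusin–Šverák 2011; Albritton–Barker 2019, Lemma 2.2 and Prop. 2.3, both proved in the tree:
  `SuitableCompactness_holds`, `PersistenceOfSingularities_holds`): if suitable weak solutions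
  `(W k, P k)` in the unit ball with the uniform `L³ × L^{3/2}` bound are essentially unbounded on
  every `Q(0, R')`, `0 < R' < 1`, and converge pointwise on `Q(0, 1/2)` to a field `Wlim`, then
  `Wlim` is unbounded near the space–time origin: along a subsequence the `W k` converge strongly in
  `L³_loc` to a suitable weak solution `u∞` which is singular at the origin (persistence), and
  `u∞ = Wlim` a.e. on `Q(0, 1/2)` (a further subsequence converges a.e.).
-/

noncomputable section

open MeasureTheory Set Function Filter TopologicalSpace Metric
open scoped Topology NNReal ENNReal InnerProductSpace RealInnerProductSpace

namespace Summit.NavierStokesRegularity.NavierStokesRegularity.Theorems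

open Literature.Analysis Literature.Analysis.FluidPDE

section Unbounded

variable {ν T : ℝ} {u : ℝ → EuclideanSpace ℝ (Fin 3) → EuclideanSpace ℝ (Fin 3)}
  {p : ℝ → EuclideanSpace ℝ (Fin 3) → ℝ} {x₀ : EuclideanSpace ℝ (Fin 3)} {R α β : ℝ}

/-- **The unit zoom at a backward singular point is essentially unbounded on every `Q(0, ρ)`,
`0 < ρ ≤ 1`**: otherwise `u` would be bounded on a backward cylinder at `(T, x₀)`
(`SereginSverak2002.isBackwardBoundedAt_of_zoom`), hence essentially bounded there. [folklore] -/
theorem eLpNorm_top_unitZoom_eq_top (hsol : IsClassicalNSSolutionOn (Ico 0 T) ν 0 u p)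
    (hR : 0 < R) (hα : 0 < α) (hβ : 0 < β) (hβT : β ≤ T)
    (hsing : ∀ r : ℝ, 0 < r →
      eLpNorm (uncurry u) ∞ (volume.restrict (parabolicCylinder r ((T : ℝ), x₀))) = ∞)
    {ρ : ℝ} (hρ : 0 < ρ) (hρ1 : ρ ≤ 1) :
    eLpNorm (uncurry (α • stPull β R T x₀ u)) ∞
      (volume.restrict (parabolicCylinder ρ (0 : ℝ × EuclideanSpace ℝ (Fin 3)))) = ∞ := by
  by_contra hfin
  obtain ⟨r, hr, K, hK⟩ := SereginSverak2002.isBackwardBoundedAt_of_zoom hsol x₀ hR hα hβ hβT hρ hρ1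
    (lt_top_iff_ne_top.2 hfin)
  have hlt : eLpNorm (uncurry u) ∞ (volume.restrict (parabolicCylinder r ((T : ℝ), x₀))) < ∞ := by
    rw [eLpNorm_exponent_top]
    refine eLpNormEssSup_lt_top_of_ae_bound (C := K) ?_
    refine (ae_restrict_mem (measurableSet_Ioo.prod measurableSet_ball)).mono ?_
    rintro ⟨t, x⟩ hz
    exact hK t hz.1 x hz.2
  exact hlt.ne (hsing r hr)

/-- **Every further zoom is essentially unbounded on every `Q(0, R')` with `c R' ≤ 1`**
(`‖v_c‖_{L^∞(Q(0,R'))} = c ‖v‖_{L^∞(Q(0, cR'))} = ∞`). [folklore] -/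
theorem eLpNorm_top_zoomIn_eq_top (hsol : IsClassicalNSSolutionOn (Ico 0 T) ν 0 u p)
    (hR : 0 < R) (hα : 0 < α) (hβ : 0 < β) (hβT : β ≤ T)
    (hsing : ∀ r : ℝ, 0 < r →
      eLpNorm (uncurry u) ∞ (volume.restrict (parabolicCylinder r ((T : ℝ), x₀))) = ∞)
    {c R' : ℝ} (hc : 0 < c) (hR' : 0 < R') (hcR' : c * R' ≤ 1) :
    eLpNorm (uncurry (c • stPull (c ^ 2) c 0 0 (α • stPull β R T x₀ u))) ∞
      (volume.restrict (parabolicCylinder R' (0 : ℝ × EuclideanSpace ℝ (Fin 3)))) = ∞ := by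
  rw [eLpNorm_top_nsZoom hc 0 0 R' 0, stAffine_sq_zero_zero,
    eLpNorm_top_unitZoom_eq_top hsol hR hα hβ hβT hsing (mul_pos hc hR') hcR',
    ENNReal.mul_top (ENNReal.ofReal_pos.2 hc).ne']

end Unbounded

section Persistence

/-- **Persistence of the singularity in the limit** (Rusin–Šverák 2011, Lemmas 2.1–2.2;
Albritton–Barker 2019, Lemma 2.2 and Prop. 2.3 — the tree's `SuitableCompactness_holds` and
`PersistenceOfSingularities_holds`). Let `(W k, P k)` be suitable weak solutions in the unit parabolic
ball in the class of A–B Def. 2.1 with `sup_k ‖W k‖_{L³(Q(0,1))} + ‖P k‖_{L^{3/2}(Q(0,1))} < ∞`, each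
essentially unbounded on every `Q(0, R')`, `0 < R' < 1`, and converging pointwise on `Q(0, 1/2)` to a
field `Wlim`. Then `Wlim` is unbounded near the space–time origin: for every `r > 0` and every `M`
there are `t ∈ (−r², 0)` and `x ∈ B(0, r)` with `M < ‖Wlim t x‖`. [cite: AlbrittonBarker2019, Lemma 2.2 and Prop. 2.3] -/
theorem unbounded_at_origin_of_zoomIn_limit
    {W : ℕ → ℝ → EuclideanSpace ℝ (Fin 3) → EuclideanSpace ℝ (Fin 3)}
    {P : ℕ → ℝ → EuclideanSpace ℝ (Fin 3) → ℝ}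
    (hInBall : ∀ k, IsSuitableWeakSolutionInBall 1 0 (W k) (P k))
    (hbound : (⨆ k, eLpNorm (uncurry (W k)) 3
        (volume.restrict (parabolicCylinder 1 (0 : ℝ × EuclideanSpace ℝ (Fin 3)))) +
      eLpNorm (uncurry (P k)) (3 / 2)
        (volume.restrict (parabolicCylinder 1 (0 : ℝ × EuclideanSpace ℝ (Fin 3))))) < ∞)
    (hsing : ∀ k, ∀ R' ∈ Ioo (0 : ℝ) 1, eLpNorm (uncurry (W k)) ∞
        (volume.restrict (parabolicCylinder R' (0 : ℝ × EuclideanSpace ℝ (Fin 3)))) = ∞)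
    {Wlim : ℝ → EuclideanSpace ℝ (Fin 3) → EuclideanSpace ℝ (Fin 3)}
    (hpt : ∀ z ∈ parabolicCylinder (1 / 2) (0 : ℝ × EuclideanSpace ℝ (Fin 3)),
      Tendsto (fun k => W k z.1 z.2) atTop (𝓝 (Wlim z.1 z.2))) :
    ∀ r > 0, ∀ M : ℝ, ∃ t ∈ Ioo (-(r ^ 2)) (0 : ℝ),
      ∃ x ∈ ball (0 : EuclideanSpace ℝ (Fin 3)) r, M < ‖Wlim t x‖ := by
  -- ## Step 1: compactness (A–B Lemma 2.2) and persistence (A–B Prop. 2.3)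
  obtain ⟨uinf, pinf, σ, hσ, hR⟩ := SuitableCompactness_holds W P hInBall hbound
  have hσt : Tendsto σ atTop atTop := hσ.tendsto_atTop
  have hboundσ : (⨆ j, eLpNorm (uncurry (W (σ j))) 3
        (volume.restrict (parabolicCylinder 1 (0 : ℝ × EuclideanSpace ℝ (Fin 3)))) +
      eLpNorm (uncurry (P (σ j))) (3 / 2)
        (volume.restrict (parabolicCylinder 1 (0 : ℝ × EuclideanSpace ℝ (Fin 3))))) < ∞ := by
    refine lt_of_le_of_lt (iSup_le fun j => ?_) hbound
    exact le_iSup (fun k => eLpNorm (uncurry (W k)) 3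
        (volume.restrict (parabolicCylinder 1 (0 : ℝ × EuclideanSpace ℝ (Fin 3)))) +
      eLpNorm (uncurry (P k)) (3 / 2)
        (volume.restrict (parabolicCylinder 1 (0 : ℝ × EuclideanSpace ℝ (Fin 3))))) (σ j)
  have hpers : IsBackwardSingularPoint uinf 0 := by
    refine PersistenceOfSingularities_holds (fun j => W (σ j)) (fun j => P (σ j)) uinf pinf
      (fun j => hInBall (σ j)) hboundσ (fun R' hR' => ⟨(hR R' hR').1, (hR R' hR').2.2.1, (hR R' hR').2.2.2⟩)
      fun R' hR' => ?_
    have e : (fun j => eLpNorm (uncurry (W (σ j))) ∞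
        (volume.restrict (parabolicCylinder R' (0 : ℝ × EuclideanSpace ℝ (Fin 3))))) = fun _ => ∞ :=
      funext fun j => hsing (σ j) R' hR'
    rw [e, limsup_const]
  -- ## Step 2: identification `uinf = Wlim` a.e. on `Q(0, 1/2)`
  set μ : Measure (ℝ × EuclideanSpace ℝ (Fin 3)) :=
    volume.restrict (parabolicCylinder (1 / 2) (0 : ℝ × EuclideanSpace ℝ (Fin 3))) with hμ
  have hhalf : (1 / 2 : ℝ) ∈ Ioo (0 : ℝ) 1 := ⟨by norm_num, by norm_num⟩
  obtain ⟨-, hmem, hL3, -⟩ := hR (1 / 2) hhalf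
  have hsub1 : parabolicCylinder (1 / 2) (0 : ℝ × EuclideanSpace ℝ (Fin 3)) ⊆
      parabolicCylinder 1 (0 : ℝ × EuclideanSpace ℝ (Fin 3)) :=
    SuitableCompactness.parabolicCylinder_zero_mono (by norm_num) (by norm_num)
  have hmeasW : ∀ j, AEStronglyMeasurable (uncurry (W (σ j))) μ := fun j =>
    ((hInBall (σ j)).1.distributional.1.aestronglyMeasurable).mono_measure
      (Measure.restrict_mono hsub1 le_rfl)
  have hmeasU : AEStronglyMeasurable (uncurry uinf) μ := hmem.aestronglyMeasurable
  have hinm : TendstoInMeasure μ (fun j => uncurry (W (σ j))) atTop (uncurry uinf) :=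
    tendstoInMeasure_of_tendsto_eLpNorm (by norm_num) hmeasW hmeasU hL3
  obtain ⟨ns, hns, hae⟩ := hinm.exists_seq_tendsto_ae
  have hident : uncurry uinf =ᵐ[μ] uncurry Wlim := by
    have hmemQ : ∀ᵐ z ∂μ, z ∈ parabolicCylinder (1 / 2) (0 : ℝ × EuclideanSpace ℝ (Fin 3)) :=
      ae_restrict_mem (isOpen_parabolicCylinder _ _).measurableSet
    filter_upwards [hae, hmemQ] with z hz hzQ
    have h2 : Tendsto (fun i => uncurry (W (σ (ns i))) z) atTop (𝓝 (uncurry Wlim z)) :=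
      (hpt z hzQ).comp (hσt.comp hns.tendsto_atTop)
    exact tendsto_nhds_unique hz h2
  -- ## Step 3: essential unboundedness of `Wlim` near the origin
  intro r hr M
  by_contra hno
  push Not at hno
  set r' : ℝ := min r (1 / 2) with hr'
  have hr'pos : 0 < r' := lt_min hr (by norm_num)
  have hr'r : r' ≤ r := min_le_left _ _
  have hr'h : r' ≤ 1 / 2 := min_le_right _ _
  have hsub' : parabolicCylinder r' (0 : ℝ × EuclideanSpace ℝ (Fin 3)) ⊆
      parabolicCylinder (1 / 2) (0 : ℝ × EuclideanSpace ℝ (Fin 3)) :=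
    SuitableCompactness.parabolicCylinder_zero_mono hr'pos.le hr'h
  -- `Wlim` is bounded by `M` on `Q(0, r') ⊆ Q(0, r)`
  have hbd : eLpNorm (uncurry Wlim) ∞
      (volume.restrict (parabolicCylinder r' (0 : ℝ × EuclideanSpace ℝ (Fin 3)))) < ∞ := by
    rw [eLpNorm_exponent_top]
    refine eLpNormEssSup_lt_top_of_ae_bound (C := M) ?_
    refine (ae_restrict_mem (isOpen_parabolicCylinder _ _).measurableSet).mono ?_
    rintro ⟨t, x⟩ hz
    rw [SuitableCompactness.mem_parabolicCylinder_zero] at hz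
    have hr2 : r' ^ 2 ≤ r ^ 2 := pow_le_pow_left₀ hr'pos.le hr'r 2
    exact hno t ⟨by linarith [hz.1.1], hz.1.2⟩ x (mem_ball_zero_iff.2 (hz.2.trans_le hr'r))
  -- but `uinf = Wlim` a.e. there and `uinf` is singular at the origin
  have hcongr : eLpNorm (uncurry uinf) ∞
      (volume.restrict (parabolicCylinder r' (0 : ℝ × EuclideanSpace ℝ (Fin 3)))) =
      eLpNorm (uncurry Wlim) ∞
        (volume.restrict (parabolicCylinder r' (0 : ℝ × EuclideanSpace ℝ (Fin 3)))) :=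
    eLpNorm_congr_ae (ae_restrict_of_ae_restrict_of_subset hsub' hident)
  have htop := hpers r' hr'pos
  rw [hcongr] at htop
  exact hbd.ne htop

end Persistence

end Summit.NavierStokesRegularity.NavierStokesRegularity.Theorems

end
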